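import Mathlib
import Summits.ValiantsHypothesis.ValiantsHypothesis.Theorems.NewtonUnitEquationsTwoProductsUniqueWords

/-! # Brick `stub_engineRadixPairCarryFree` — crux `TwoProducts` (stmt-ValiantsHypothesis-5906), line `corner-log-linearization`

CARRY-FREE TWO-PRODUCT RIGID RADIX.  Fix a radix `M ≥ 2` and digit polynomials `φ_i, ψ_i ∈ ℂ[x,y]` (`i < k`) with
constant term `1` whose exponents lie in the box `[0, M)²`, and put `u_i := expand (M^i) φ_i = φ_i(x^{M^i}, y^{M^i})`,
`v_i := expand (M^i) ψ_i`.  Then every strict `w`-minimiser `e` (for a weight `w` with both entries positive) of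
`supp (∏ u_i − ∏ v_i)` is a scaled letter: `e = M^i • d` for some scale `i` and some nonzero `d` in
`supp φ_i ∪ supp ψ_i` at which `φ_i` and `ψ_i` have different coefficients.

Proof.  (a) `expand p` (`p ≥ 1`) keeps constant terms and `supp (expand p f) = p • supp f`,
`coeff_{p•d} (expand p f) = coeff_d f` (Mathlib: `coeff_expand_zero`, `support_expand`, `coeff_expand_smul`).
(b) UNIQUE READABILITY of the families `u, v`: a word `d` with `d_i ∈ supp u_i ∪ supp v_i` has `d_i = M^i • δ_i` with both
coordinates of `δ_i` below `M`, so `∑_i d_i` records, coordinatewise, the base-`M` expansions with digits `δ_i 0`, `δ_i 1`;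
base-`M` expansions of a fixed length are unique (`rp_digits_inj`, induction on the length peeling off the lowest digit with
`% M` and `/ M`), hence `∑ d_i = ∑ d'_i` forces `d = d'` (`rp_words_unique`).  (c) By the unique-words brick
`UniqueWords.stub_engineUniqueWords` (file `NewtonUnitEquationsTwoProductsUniqueWords.lean` of this directory) a strict minimiser `e` of `supp (∏ u_i − ∏ v_i)` is nonzero and is, for some `i`, a
support point of `u_i` or `v_i` with `coeff_e u_i ≠ coeff_e v_i`; by (a) `e = M^i • d` with `d ∈ supp φ_i ∪ supp ψ_i`,
`d ≠ 0`, and `coeff_d φ_i = coeff_e u_i ≠ coeff_e v_i = coeff_d ψ_i`. [folklore] -/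

set_option linter.dupNamespace false -- single-conjunct summit: `ValiantsHypothesis.ValiantsHypothesis`

namespace Summit.ValiantsHypothesis.ValiantsHypothesis.Theorems.TwoProducts.RadixPairCarryFree

open scoped BigOperators Classical

open MvPolynomial

/-! ## Base-`M` uniqueness -/

/-- Base-`M` digit strings of a fixed length `k` are determined by their value
`∑_{i<k} M^i · a_i` (all digits `< M`). [folklore] -/
theorem rp_digits_inj (M : ℕ) : ∀ (k : ℕ) (a b : Fin k → ℕ), (∀ i, a i < M) → (∀ i, b i < M) →
    ∑ i : Fin k, M ^ (i : ℕ) * a i = ∑ i : Fin k, M ^ (i : ℕ) * b i → a = b := by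
  intro k
  induction k with
  | zero =>
    intro a b _ _ _
    funext i
    exact i.elim0
  | succ k ih =>
    intro a b ha hb h
    have hsum : ∀ c : Fin (k + 1) → ℕ,
        ∑ i : Fin (k + 1), M ^ (i : ℕ) * c i = c 0 + M * ∑ i : Fin k, M ^ (i : ℕ) * c i.succ := by
      intro c
      rw [Fin.sum_univ_succ, Finset.mul_sum]
      simp only [Fin.val_zero, pow_zero, one_mul, Fin.val_succ, pow_succ]
      refine congrArg _ (Finset.sum_congr rfl fun i _ => ?_)
      ring
    rw [hsum a, hsum b] at h
    have h0 : a 0 = b 0 := by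
      have hmod := congrArg (· % M) h
      simpa only [Nat.add_mul_mod_self_left, Nat.mod_eq_of_lt (ha 0), Nat.mod_eq_of_lt (hb 0)] using hmod
    have hM : 0 < M := lt_of_le_of_lt (Nat.zero_le _) (ha 0)
    have h1 : ∑ i : Fin k, M ^ (i : ℕ) * a i.succ = ∑ i : Fin k, M ^ (i : ℕ) * b i.succ := by
      rw [h0] at h
      exact Nat.eq_of_mul_eq_mul_left hM (Nat.add_left_cancel h)
    have htail := ih (fun i => a i.succ) (fun i => b i.succ) (fun i => ha _) (fun i => hb _) h1
    funext i
    refine Fin.cases ?_ (fun j => ?_) i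
    · exact h0
    · exact congrFun htail j

/-! ## Letters of expanded polynomials -/

/-- A support point of `expand p f` or of `expand p g` (`p ≠ 0`) is `p •` a support point of `f` or of `g`. [folklore] -/
theorem rp_letter {p : ℕ} (hp : p ≠ 0) (f g : MvPolynomial (Fin 2) ℂ) {e : Fin 2 →₀ ℕ}
    (he : e ∈ (expand p f).support ∪ (expand p g).support) :
    ∃ δ : Fin 2 →₀ ℕ, (δ ∈ f.support ∨ δ ∈ g.support) ∧ e = p • δ := by
  rcases Finset.mem_union.1 he with h | h
  · rw [support_expand _ hp, Finset.mem_image] at h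
    obtain ⟨δ, hδ, hδe⟩ := h
    exact ⟨δ, Or.inl hδ, hδe.symm⟩
  · rw [support_expand _ hp, Finset.mem_image] at h
    obtain ⟨δ, hδ, hδe⟩ := h
    exact ⟨δ, Or.inr hδ, hδe.symm⟩

/-- UNIQUE READABILITY for carry-free radix families: if every exponent of `φ_i, ψ_i` lies in the box `[0, M)²`
(`M ≥ 2`), then a word `d` with letters `d_i ∈ supp (expand (M^i) φ_i) ∪ supp (expand (M^i) ψ_i)` is determined by
its sum `∑_i d_i`. [folklore] -/
theorem rp_words_unique {k M : ℕ} (hM : 2 ≤ M) (φ ψ : Fin k → MvPolynomial (Fin 2) ℂ)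
    (hφ : ∀ i, ∀ d ∈ (φ i).support, d 0 < M ∧ d 1 < M) (hψ : ∀ i, ∀ d ∈ (ψ i).support, d 0 < M ∧ d 1 < M)
    (d d' : Fin k → (Fin 2 →₀ ℕ))
    (hd : ∀ i : Fin k, d i ∈ (expand (M ^ (i : ℕ)) (φ i)).support ∪ (expand (M ^ (i : ℕ)) (ψ i)).support)
    (hd' : ∀ i : Fin k, d' i ∈ (expand (M ^ (i : ℕ)) (φ i)).support ∪ (expand (M ^ (i : ℕ)) (ψ i)).support)
    (hsum : ∑ i, d i = ∑ i, d' i) : d = d' := by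
  have hletter : ∀ c : Fin k → (Fin 2 →₀ ℕ),
      (∀ i : Fin k, c i ∈ (expand (M ^ (i : ℕ)) (φ i)).support ∪ (expand (M ^ (i : ℕ)) (ψ i)).support) →
      ∃ δ : Fin k → (Fin 2 →₀ ℕ), (∀ i : Fin k, c i = M ^ (i : ℕ) • δ i) ∧ ∀ i, δ i 0 < M ∧ δ i 1 < M := by
    intro c hc
    have hex : ∀ i : Fin k, ∃ δ : Fin 2 →₀ ℕ, c i = M ^ (i : ℕ) • δ ∧ (δ 0 < M ∧ δ 1 < M) := by
      intro i
      obtain ⟨δ, hδ, hcδ⟩ := rp_letter (pow_ne_zero _ (by omega)) (φ i) (ψ i) (hc i)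
      rcases hδ with hδ | hδ
      · exact ⟨δ, hcδ, hφ i δ hδ⟩
      · exact ⟨δ, hcδ, hψ i δ hδ⟩
    choose δ hδ using hex
    exact ⟨δ, fun i => (hδ i).1, fun i => (hδ i).2⟩
  obtain ⟨δ, hdδ, hδM⟩ := hletter d hd
  obtain ⟨δ', hdδ', hδM'⟩ := hletter d' hd'
  have hcoord : ∀ c : Fin 2, (fun i => δ i c) = (fun i => δ' i c) := by
    intro c
    have hc : ∀ i, δ i c < M := fun i => by
      fin_cases c
      exacts [(hδM i).1, (hδM i).2]
    have hc' : ∀ i, δ' i c < M := fun i => by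
      fin_cases c
      exacts [(hδM' i).1, (hδM' i).2]
    refine rp_digits_inj M k _ _ hc hc' ?_
    have happ := congrArg (fun f : (Fin 2 →₀ ℕ) => f c) hsum
    simpa only [Finsupp.finsetSum_apply, hdδ, hdδ', Finsupp.smul_apply, smul_eq_mul] using happ
  funext i
  rw [hdδ, hdδ']
  congr 1
  ext c
  exact congrFun (hcoord c) i

/-! ## The brick -/

/-- **`stub_engineRadixPairCarryFree`** (CARRY-FREE TWO-PRODUCT RIGID RADIX).  For a radix `M ≥ 2` and digit polynomials
`φ_i, ψ_i` (`i < k`) with constant terms `1` and exponents in the box `[0, M)²`, every strict minimiser `e` of a positive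
weight `w` on `supp (∏_i expand (M^i) φ_i − ∏_i expand (M^i) ψ_i)` is `M^i • d` for a scale `i` and a nonzero exponent
`d ∈ supp φ_i ∪ supp ψ_i` with `coeff_d φ_i ≠ coeff_d ψ_i`. [folklore] -/
theorem stub_engineRadixPairCarryFree :
    ∀ (k M : ℕ) (φ ψ : Fin k → MvPolynomial (Fin 2) ℂ), 2 ≤ M →
    (∀ i, MvPolynomial.coeff 0 (φ i) = 1) → (∀ i, MvPolynomial.coeff 0 (ψ i) = 1) →
    (∀ i, ∀ d ∈ (φ i).support, d 0 < M ∧ d 1 < M) → (∀ i, ∀ d ∈ (ψ i).support, d 0 < M ∧ d 1 < M) →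
    ∀ (w : Fin 2 → ℤ), 0 < w 0 → 0 < w 1 → ∀ (e : Fin 2 →₀ ℕ),
    (e ∈ ((∏ i : Fin k, MvPolynomial.expand (M ^ (i : ℕ)) (φ i)) - ∏ i : Fin k, MvPolynomial.expand (M ^ (i : ℕ)) (ψ i)).support ∧
      ∀ e' ∈ ((∏ i : Fin k, MvPolynomial.expand (M ^ (i : ℕ)) (φ i)) - ∏ i : Fin k, MvPolynomial.expand (M ^ (i : ℕ)) (ψ i)).support,
        e' ≠ e → w 0 * (e 0 : ℤ) + w 1 * (e 1 : ℤ) < w 0 * (e' 0 : ℤ) + w 1 * (e' 1 : ℤ)) →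
    ∃ (i : Fin k) (d : Fin 2 →₀ ℕ), d ≠ 0 ∧ (d ∈ (φ i).support ∨ d ∈ (ψ i).support) ∧
      MvPolynomial.coeff d (φ i) ≠ MvPolynomial.coeff d (ψ i) ∧ e = (M ^ (i : ℕ)) • d := by
  intro k M φ ψ hM hφ0 hψ0 hφ hψ w hw0 hw1 e he
  have hMi : ∀ i : Fin k, M ^ (i : ℕ) ≠ 0 := fun i => pow_ne_zero _ (by omega)
  have hu0 : ∀ i : Fin k, coeff 0 (expand (M ^ (i : ℕ)) (φ i)) = 1 := fun i => by
    rw [coeff_expand_zero _ (hMi i), hφ0 i]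
  have hv0 : ∀ i : Fin k, coeff 0 (expand (M ^ (i : ℕ)) (ψ i)) = 1 := fun i => by
    rw [coeff_expand_zero _ (hMi i), hψ0 i]
  obtain ⟨hne, i, hmem, hcoeff⟩ := UniqueWords.stub_engineUniqueWords k (fun i => expand (M ^ (i : ℕ)) (φ i))
    (fun i => expand (M ^ (i : ℕ)) (ψ i)) hu0 hv0 (fun d d' hd hd' hs => rp_words_unique hM φ ψ hφ hψ d d' hd hd' hs)
    w hw0 hw1 e he
  obtain ⟨d, hd, rfl⟩ := rp_letter (hMi i) (φ i) (ψ i) (Finset.mem_union.2 hmem)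
  refine ⟨i, d, ?_, hd, ?_, rfl⟩
  · rintro rfl
    exact hne (smul_zero _)
  · rwa [coeff_expand_smul _ (hMi i), coeff_expand_smul _ (hMi i)] at hcoeff

end Summit.ValiantsHypothesis.ValiantsHypothesis.Theorems.TwoProducts.RadixPairCarryFree
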